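import Mathlib.Analysis.SpecialFunctions.Log.Basic
import Mathlib.Algebra.Order.Field.GeomSum
import Literature.Probability.Percolation.ClusterBundling
import Literature.Probability.Percolation.BKFinitary
import Literature.Probability.LatticeModels.ProdBernoulliBK
import HarnessLib

/-!
# Universal tightness of the maximum cluster size (Hutchcroft 2021, Thm. 2.2)

Topic `Literature/Probability/Percolation`. For percolation on a countable vertex set `V` under an
arbitrary product Bernoulli measure on the pairs (`prodBernoulli p`, i.e. Hutchcroft's "Bernoulli-`β`
bond percolation on a weighted graph", `p_e = 1 - e^{-βJ_e}`) and a finite nonempty `Λ ⊆ V`,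
the maximum cluster size `|K_max(Λ)| = max_v |K_v ∩ Λ|` is of the order of its typical value
`M(Λ) = min{n : P(|K_max(Λ)| ≥ n) ≤ e^{-1}}` with high probability (Hutchcroft, PTRF 181 (2021),
Thm. 2.2: "`ℙ_β(|K_max(Λ)| ≥ αM) ≤ exp(-α/9)`", "`ℙ_β(|K_max(Λ)| < εM) ≤ 27ε`",
"`ℙ_β(|K_u ∩ Λ| ≥ αM) ≤ e ℙ_β(|K_u ∩ Λ| ≥ M) exp(-α/9)`"). These are the inequalities
(2.5)–(2.7) of Hutchcroft 2022 on which the renormalisation of the maximum cluster size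
(Lemma 2.6, Lemma 2.9) rests.

Contents (all proved; the constants differ from the printed ones because the witnesses come from
the linear bundling of `ClusterBundling.lean` instead of the `3`-adic Lemma 2.4 — only the
existence of universal constants is used downstream):

* `clusterCapIn Λ ω v = |K_v ∩ Λ|`, `clusterMaxIn Λ ω = |K_max(Λ)|`, `typicalMax μ Λ = M(Λ)`
  (definitions as printed, 2021 §2.1), elementary properties, monotonicity, the events
  `{|K_v ∩ Λ| ≥ s}`, `{|K_max(Λ)| ≥ s}` are increasing, finitary and measurable;
* witness inclusions (2021, (2.8)/(2.9)) and, by the BK inequality (`prodBernoulli_bk_list`),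
  **Thm. 2.3 in linear form**: `P(|K_max| ≥ (2N+1)t) ≤ P(|K_max| ≥ t)^{N+1}`,
  `P(|K_u ∩ Λ| ≥ (2N+1)t) ≤ P(|K_u ∩ Λ| ≥ t) P(|K_max| ≥ t)^N` (`t ≥ 1`, `N ≥ 0` integers);
* `M(Λ)`: `P(|K_max| ≥ M) ≤ e^{-1} < P(|K_max| ≥ n)` for `n < M`, `2 ≤ M ≤ |Λ| + 1`;
* **Thm. 2.2 (universal tightness)**: `P(|K_max| ≥ (2N+1)M) ≤ e^{-(N+1)}`,
  `P(|K_max| ≥ αM) ≤ exp((1-α)/2)` (`α ≥ 1`), `P(|K_u ∩ Λ| ≥ αM) ≤ exp((3-α)/2) P(|K_u ∩ Λ| ≥ M)`,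
  `P(|K_max| < εM) ≤ 8ε` (`ε > 0`);
* mean versus typical value (2022, (2.7)): layer cake `E|K_max| = Σ_{n=1}^{|Λ|} P(|K_max| ≥ n)`,
  `(M-1)e^{-1} ≤ E|K_max| ≤ 4M`.

## References

* [Hutchcroft2021] T. Hutchcroft, *Power-law bounds for critical long-range percolation below the
  upper-critical dimension*, Probab. Theory Related Fields 181 (2021) 533–570, arXiv:2008.11197:
  §2.1, Thm. 2.2 (2.3)–(2.5), Thm. 2.3 (2.6)–(2.7) and their proofs (pp. 11–13).
* [Hutchcroft2022] T. Hutchcroft, J. Math. Phys. 63 (2022), arXiv:2202.07634, §2.2 (2.5)–(2.7).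
-/

noncomputable section

namespace Literature.Probability.Percolation

open MeasureTheory Finset Literature.Probability.LatticeModels
open scoped ENNReal

variable {V : Type*}

/-! ### The maximum cluster size in a finite region -/

open Classical in
/-- `|K_v ∩ Λ|`: the number of vertices of the finite set `Λ` in the open cluster of `v`.
[cite: Hutchcroft2021, §2.1 (p. 11)] -/
def clusterCapIn (Λ : Finset V) (ω : BondConfig V) (v : V) : ℕ :=
  (Λ.filter fun z => (openGraph ω).Reachable v z).card

/-- **The maximum cluster size in `Λ`**, "`|K_max(Λ)| = max{|K_v ∩ Λ| : v ∈ V} =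
max{|K_v ∩ Λ| : v ∈ Λ}`" (`0` for `Λ = ∅`). [cite: Hutchcroft2021, §2.1 (p. 11)] -/
def clusterMaxIn (Λ : Finset V) (ω : BondConfig V) : ℕ :=
  Λ.sup fun v => clusterCapIn Λ ω v

/-- **The typical value of `|K_max(Λ)|`**, "`M_β(Λ) := min{n ≥ 0 : ℙ_β(|K_max(Λ)| ≥ n) ≤ e^{-1}}`".
[cite: Hutchcroft2021, §2.1 (p. 11)] -/
def typicalMax (μ : Measure (BondConfig V)) (Λ : Finset V) : ℕ :=
  sInf {n : ℕ | μ.real {ω | n ≤ clusterMaxIn Λ ω} ≤ Real.exp (-1)}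

section Deterministic

open Classical in
/-- Unfolding of `clusterCapIn`. [folklore] -/
theorem clusterCapIn_eq (Λ : Finset V) (ω : BondConfig V) (v : V) :
    clusterCapIn Λ ω v = (Λ.filter fun z => (openGraph ω).Reachable v z).card := by
  rw [clusterCapIn]

/-- `|K_v ∩ Λ| ≤ |Λ|`. [folklore] -/
theorem clusterCapIn_le_card (Λ : Finset V) (ω : BondConfig V) (v : V) :
    clusterCapIn Λ ω v ≤ Λ.card := by
  classical
  rw [clusterCapIn_eq]; exact card_filter_le _ _

/-- `|K_max(Λ)| ≤ |Λ|`. [folklore] -/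
theorem clusterMaxIn_le_card (Λ : Finset V) (ω : BondConfig V) : clusterMaxIn Λ ω ≤ Λ.card :=
  Finset.sup_le fun v _ => clusterCapIn_le_card Λ ω v

/-- `|K_v ∩ Λ| ≤ |K_max(Λ)|` for `v ∈ Λ`. [cite: Hutchcroft2021, §2.1 (p. 11)] -/
theorem clusterCapIn_le_clusterMaxIn {Λ : Finset V} {v : V} (hv : v ∈ Λ) (ω : BondConfig V) :
    clusterCapIn Λ ω v ≤ clusterMaxIn Λ ω :=
  Finset.le_sup (f := fun v => clusterCapIn Λ ω v) hv

/-- Vertices of one cluster see the same trace on `Λ`. [folklore] -/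
theorem clusterCapIn_eq_of_reachable (Λ : Finset V) {ω : BondConfig V} {v w : V}
    (h : (openGraph ω).Reachable v w) : clusterCapIn Λ ω v = clusterCapIn Λ ω w := by
  classical
  rw [clusterCapIn_eq, clusterCapIn_eq]
  congr 1
  ext z
  simp only [mem_filter, and_congr_right_iff]
  exact fun _ => ⟨fun hz => h.symm.trans hz, fun hz => h.trans hz⟩

/-- `|K_v ∩ Λ| ≤ |K_max(Λ)|` for every vertex `v` ("`max{|K_v ∩ Λ| : v ∈ V} =
max{|K_v ∩ Λ| : v ∈ Λ}`"). [cite: Hutchcroft2021, §2.1 (p. 11)] -/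
theorem clusterCapIn_le_clusterMaxIn' (Λ : Finset V) (ω : BondConfig V) (v : V) :
    clusterCapIn Λ ω v ≤ clusterMaxIn Λ ω := by
  classical
  by_cases h : ∃ z ∈ Λ, (openGraph ω).Reachable v z
  · obtain ⟨z, hz, hvz⟩ := h
    rw [clusterCapIn_eq_of_reachable Λ hvz]
    exact clusterCapIn_le_clusterMaxIn hz ω
  · push Not at h
    rw [clusterCapIn_eq]
    have : Λ.filter (fun z => (openGraph ω).Reachable v z) = ∅ :=
      filter_eq_empty_iff.2 fun z hz => h z hz
    rw [this, card_empty]; exact Nat.zero_le _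

/-- `|K_max(Λ)| ≥ 1` for nonempty `Λ`. [cite: Hutchcroft2022, §2.2 (p. 7, "we always have M_B ≥ 2")] -/
theorem one_le_clusterMaxIn {Λ : Finset V} (hΛ : Λ.Nonempty) (ω : BondConfig V) :
    1 ≤ clusterMaxIn Λ ω := by
  classical
  obtain ⟨v, hv⟩ := hΛ
  refine le_trans ?_ (clusterCapIn_le_clusterMaxIn hv ω)
  rw [clusterCapIn_eq]
  exact card_pos.2 ⟨v, mem_filter.2 ⟨hv, SimpleGraph.Reachable.refl v⟩⟩

/-- The maximum is attained: `|K_max(Λ)| = |K_v ∩ Λ|` for some `v ∈ Λ` (nonempty `Λ`). [folklore] -/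
theorem exists_clusterCapIn_eq_clusterMaxIn {Λ : Finset V} (hΛ : Λ.Nonempty) (ω : BondConfig V) :
    ∃ v ∈ Λ, clusterMaxIn Λ ω = clusterCapIn Λ ω v :=
  Finset.exists_mem_eq_sup Λ hΛ fun v => clusterCapIn Λ ω v

/-- `|K_v ∩ Λ|` is non-decreasing in the configuration. [folklore] -/
theorem clusterCapIn_mono (Λ : Finset V) (v : V) : Monotone fun ω => clusterCapIn Λ ω v := by
  classical
  intro ω ω' h
  simp only [clusterCapIn_eq]
  exact card_le_card fun z hz => mem_filter.2 ⟨(mem_filter.1 hz).1,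
    (mem_filter.1 hz).2.mono (openGraph_mono h)⟩

/-- `|K_max(Λ)|` is non-decreasing in the configuration. [folklore] -/
theorem clusterMaxIn_mono (Λ : Finset V) : Monotone (clusterMaxIn Λ (V := V)) := by
  intro ω ω' h
  exact Finset.sup_le fun v hv =>
    le_trans (clusterCapIn_mono Λ v h) (clusterCapIn_le_clusterMaxIn hv ω')

/-- `{|K_v ∩ Λ| ≥ s}` is increasing. [folklore] -/
theorem isUpperSet_clusterCapIn_ge (Λ : Finset V) (v : V) (s : ℕ) :
    IsUpperSet {ω : BondConfig V | s ≤ clusterCapIn Λ ω v} :=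
  fun _ _ h hω => le_trans hω (clusterCapIn_mono Λ v h)

/-- `{|K_max(Λ)| ≥ s}` is increasing. [folklore] -/
theorem isUpperSet_clusterMaxIn_ge (Λ : Finset V) (s : ℕ) :
    IsUpperSet {ω : BondConfig V | s ≤ clusterMaxIn Λ ω} :=
  fun _ _ h hω => le_trans hω (clusterMaxIn_mono Λ h)

open Classical in
/-- A finite edge set connecting `t ≥ 1` vertices of `Λ` to one vertex lies in `{|K_max(Λ)| ≥ t}`.
[folklore] -/
theorem clusterMaxIn_ge_of_witness {Λ : Finset V} {t : ℕ} (ht : 1 ≤ t) {ω : BondConfig V} {y : V}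
    (h : t ≤ (Λ.filter fun z => (openGraph ω).Reachable y z).card) : t ≤ clusterMaxIn Λ ω := by
  obtain ⟨z₀, hz₀⟩ : (Λ.filter fun z => (openGraph ω).Reachable y z).Nonempty :=
    card_pos.1 (lt_of_lt_of_le (by omega) h)
  obtain ⟨hz₀Λ, hyz₀⟩ := mem_filter.1 hz₀
  refine le_trans ?_ (clusterCapIn_le_clusterMaxIn hz₀Λ ω)
  rw [clusterCapIn_eq, ← clusterCapIn_eq, ← clusterCapIn_eq_of_reachable Λ hyz₀, clusterCapIn_eq]
  convert h

variable [DecidableEq V]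

/-- `{|K_v ∩ Λ| ≥ s}` is finitary: a configuration in it contains finitely many open edges that
already connect `s` vertices of `Λ` to `v`. [folklore] -/
theorem isFinitary_clusterCapIn_ge (Λ : Finset V) (v : V) (s : ℕ) :
    IsFinitary {ω : BondConfig V | s ≤ clusterCapIn Λ ω v} := by
  classical
  intro ω hω
  rcases Nat.eq_zero_or_pos s with rfl | hs
  · exact ⟨∅, by simp, Nat.zero_le _⟩
  · simp only [Set.mem_setOf_eq, clusterCapIn_eq] at hω
    obtain ⟨W, hlen, hsub, -, -, hroot⟩ := exists_disjoint_cluster_witnesses ω Λ v 0 s hs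
      (Λ.filter fun z => (openGraph ω).Reachable v z)
      (fun y hy => ⟨(mem_filter.1 hy).1, (mem_filter.1 hy).2⟩) (by simpa using hω)
    obtain ⟨F, rest, rfl⟩ : ∃ F rest, W = F :: rest := by
      rcases W with _ | ⟨F, rest⟩
      · simp at hlen
      · exact ⟨F, rest, rfl⟩
    refine ⟨F, hsub F (by simp), ?_⟩
    simp only [Set.mem_setOf_eq, clusterCapIn_eq]
    exact hroot F rest rfl

/-- `{|K_max(Λ)| ≥ s}` is finitary. [folklore] -/
theorem isFinitary_clusterMaxIn_ge (Λ : Finset V) (s : ℕ) :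
    IsFinitary {ω : BondConfig V | s ≤ clusterMaxIn Λ ω} := by
  intro ω hω
  rcases Nat.eq_zero_or_pos s with rfl | hs
  · exact ⟨∅, by simp, Nat.zero_le _⟩
  · have hΛ : Λ.Nonempty := by
      by_contra h
      rw [not_nonempty_iff_eq_empty] at h
      subst h
      simp [clusterMaxIn] at hω
      omega
    obtain ⟨v, hv, heq⟩ := exists_clusterCapIn_eq_clusterMaxIn hΛ ω
    simp only [Set.mem_setOf_eq, heq] at hω
    obtain ⟨K, hK, hKmem⟩ := isFinitary_clusterCapIn_ge Λ v s ω hω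
    exact ⟨K, hK, le_trans hKmem (clusterCapIn_le_clusterMaxIn hv _)⟩

/-- `{|K_v ∩ Λ| ≥ s}` is measurable (`V` countable). [folklore] -/
theorem measurableSet_clusterCapIn_ge [Countable V] (Λ : Finset V) (v : V) (s : ℕ) :
    MeasurableSet {ω : BondConfig V | s ≤ clusterCapIn Λ ω v} :=
  (isFinitary_clusterCapIn_ge Λ v s).measurableSet (isUpperSet_clusterCapIn_ge Λ v s)

/-- `{|K_max(Λ)| ≥ s}` is measurable (`V` countable). [folklore] -/
theorem measurableSet_clusterMaxIn_ge [Countable V] (Λ : Finset V) (s : ℕ) :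
    MeasurableSet {ω : BondConfig V | s ≤ clusterMaxIn Λ ω} :=
  (isFinitary_clusterMaxIn_ge Λ s).measurableSet (isUpperSet_clusterMaxIn_ge Λ s)

/-- **Witness inclusion, unrooted** (Hutchcroft 2021, proof of Thm. 2.3, (2.8)): for `t ≥ 1`,
`{|K_max(Λ)| ≥ (2N+1)t} ⊆ {|K_max(Λ)| ≥ t} □ ⋯ □ {|K_max(Λ)| ≥ t}` (`N+1` copies).
[cite: Hutchcroft2021, proof of Thm. 2.3 (p. 13)] -/
theorem setOf_clusterMaxIn_ge_subset_disjointOccurrenceList (Λ : Finset V) {N t : ℕ} (ht : 1 ≤ t) :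
    {ω : BondConfig V | (2 * N + 1) * t ≤ clusterMaxIn Λ ω} ⊆
      disjointOccurrenceList (List.replicate (N + 1) {ω : BondConfig V | t ≤ clusterMaxIn Λ ω}) := by
  classical
  intro ω hω
  have hΛ : Λ.Nonempty := by
    by_contra h
    rw [not_nonempty_iff_eq_empty] at h
    subst h
    simp [clusterMaxIn] at hω
    omega
  obtain ⟨v, hv, heq⟩ := exists_clusterCapIn_eq_clusterMaxIn hΛ ω
  simp only [Set.mem_setOf_eq, heq, clusterCapIn_eq] at hω
  obtain ⟨W, hlen, hsub, hdisj, hwit, -⟩ := exists_disjoint_cluster_witnesses ω Λ v N t ht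
    (Λ.filter fun z => (openGraph ω).Reachable v z)
    (fun y hy => ⟨(mem_filter.1 hy).1, (mem_filter.1 hy).2⟩) (by simpa using hω)
  have key := mem_disjointOccurrenceList_of_pairwise_disjoint
    (W.map fun F : Finset (Sym2 V) => ({ω : BondConfig V | t ≤ clusterMaxIn Λ ω}, (↑F : Set (Sym2 V))))
    (fun p hp => by
      obtain ⟨F, -, rfl⟩ := List.mem_map.1 hp
      exact isUpperSet_clusterMaxIn_ge Λ t)
    (fun p hp => by
      obtain ⟨F, hF, rfl⟩ := List.mem_map.1 hp
      obtain ⟨y, hy⟩ := hwit F hF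
      exact clusterMaxIn_ge_of_witness ht hy)
    (by
      rw [List.pairwise_map]
      exact hdisj.imp fun h => Finset.disjoint_coe.2 h)
    (ω := ω) (fun p hp => by
      obtain ⟨F, hF, rfl⟩ := List.mem_map.1 hp
      exact hsub F hF)
  rw [List.map_map] at key
  convert key using 2
  refine (List.eq_replicate_iff.2 ⟨by simp [hlen], fun B hB => ?_⟩).symm
  obtain ⟨F, -, rfl⟩ := List.mem_map.1 hB
  rfl

/-- **Witness inclusion, rooted** (Hutchcroft 2021, proof of Thm. 2.3, (2.9)): for `t ≥ 1`,
`{|K_u ∩ Λ| ≥ (2N+1)t} ⊆ {|K_u ∩ Λ| ≥ t} □ ({|K_max(Λ)| ≥ t} □ ⋯)` (`N` unrooted copies).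
[cite: Hutchcroft2021, proof of Thm. 2.3 (p. 13)] -/
theorem setOf_clusterCapIn_ge_subset_disjointOccurrenceList (Λ : Finset V) (u : V) {N t : ℕ}
    (ht : 1 ≤ t) :
    {ω : BondConfig V | (2 * N + 1) * t ≤ clusterCapIn Λ ω u} ⊆
      disjointOccurrenceList ({ω : BondConfig V | t ≤ clusterCapIn Λ ω u} ::
        List.replicate N {ω : BondConfig V | t ≤ clusterMaxIn Λ ω}) := by
  classical
  intro ω hω
  simp only [Set.mem_setOf_eq, clusterCapIn_eq] at hω
  obtain ⟨W, hlen, hsub, hdisj, hwit, hroot⟩ := exists_disjoint_cluster_witnesses ω Λ u N t ht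
    (Λ.filter fun z => (openGraph ω).Reachable u z)
    (fun y hy => ⟨(mem_filter.1 hy).1, (mem_filter.1 hy).2⟩) (by simpa using hω)
  obtain ⟨F₀, rest, rfl⟩ : ∃ F₀ rest, W = F₀ :: rest := by
    rcases W with _ | ⟨F₀, rest⟩
    · simp at hlen
    · exact ⟨F₀, rest, rfl⟩
  have key := mem_disjointOccurrenceList_of_pairwise_disjoint
    (({ω : BondConfig V | t ≤ clusterCapIn Λ ω u}, (↑F₀ : Set (Sym2 V))) ::
      rest.map fun F : Finset (Sym2 V) =>
        ({ω : BondConfig V | t ≤ clusterMaxIn Λ ω}, (↑F : Set (Sym2 V))))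
    (fun p hp => by
      rcases List.mem_cons.1 hp with rfl | hp
      · exact isUpperSet_clusterCapIn_ge Λ u t
      · obtain ⟨F, -, rfl⟩ := List.mem_map.1 hp
        exact isUpperSet_clusterMaxIn_ge Λ t)
    (fun p hp => by
      rcases List.mem_cons.1 hp with rfl | hp
      · simp only [Set.mem_setOf_eq, clusterCapIn_eq]
        exact hroot F₀ rest rfl
      · obtain ⟨F, hF, rfl⟩ := List.mem_map.1 hp
        obtain ⟨y, hy⟩ := hwit F (by simp [hF])
        exact clusterMaxIn_ge_of_witness ht hy)
    (by
      rw [List.pairwise_cons]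
      constructor
      · intro p hp
        obtain ⟨F, hF, rfl⟩ := List.mem_map.1 hp
        exact Finset.disjoint_coe.2 ((List.pairwise_cons.1 hdisj).1 F hF)
      · rw [List.pairwise_map]
        exact (List.pairwise_cons.1 hdisj).2.imp fun h => Finset.disjoint_coe.2 h)
    (ω := ω) (fun p hp => by
      rcases List.mem_cons.1 hp with rfl | hp
      · exact hsub F₀ (by simp)
      · obtain ⟨F, hF, rfl⟩ := List.mem_map.1 hp
        exact hsub F (by simp [hF]))
  rw [List.map_cons, List.map_map] at key
  convert key using 3
  refine (List.eq_replicate_iff.2 ⟨by simp at hlen ⊢; omega, fun B hB => ?_⟩).symm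
  obtain ⟨F, -, rfl⟩ := List.mem_map.1 hB
  rfl

end Deterministic

/-! ### Sub-multiplicativity of the tails (Hutchcroft 2021, Thm. 2.3) -/

section Submult

variable [DecidableEq V] [Countable V] (p : Sym2 V → unitInterval)

/-- **Sub-multiplicativity of the tail of `|K_max(Λ)|`** (Hutchcroft 2021, Thm. 2.3, (2.6), in the
linear form furnished by `ClusterBundling.lean`): for integers `N ≥ 0`, `t ≥ 1`,
`P(|K_max(Λ)| ≥ (2N+1)t) ≤ P(|K_max(Λ)| ≥ t)^{N+1}` under any product Bernoulli measure on the
edges (BK inequality for the `N+1` disjoint witnesses). For `2N+1 = 3^k` this contains the printed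
`ℙ_β(|K_max(Λ)| ≥ 3^k λ) ≤ ℙ_β(|K_max(Λ)| ≥ λ)^{3^{k-1}+1}` for integer `λ`.
[cite: Hutchcroft2021, Thm. 2.3 (2.6)] -/
theorem prodBernoulli_real_clusterMaxIn_ge_mul_le (Λ : Finset V) {N t : ℕ} (ht : 1 ≤ t) :
    (prodBernoulli p).real {ω | (2 * N + 1) * t ≤ clusterMaxIn Λ ω} ≤
      (prodBernoulli p).real {ω | t ≤ clusterMaxIn Λ ω} ^ (N + 1) := by
  refine le_trans (measureReal_mono (setOf_clusterMaxIn_ge_subset_disjointOccurrenceList Λ ht)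
    (measure_ne_top _ _)) ?_
  refine le_trans (prodBernoulli_bk_list p _ (fun A hA => ?_) (fun A hA => ?_)) ?_
  · rw [List.eq_of_mem_replicate hA]; exact isUpperSet_clusterMaxIn_ge Λ t
  · rw [List.eq_of_mem_replicate hA]; exact isFinitary_clusterMaxIn_ge Λ t
  · rw [List.map_replicate, List.prod_replicate]

/-- **Sub-multiplicativity of the tail of `|K_u ∩ Λ|`** (Hutchcroft 2021, Thm. 2.3, (2.7), linear
form): `P(|K_u ∩ Λ| ≥ (2N+1)t) ≤ P(|K_u ∩ Λ| ≥ t) · P(|K_max(Λ)| ≥ t)^N` for integers `N ≥ 0`,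
`t ≥ 1`. [cite: Hutchcroft2021, Thm. 2.3 (2.7)] -/
theorem prodBernoulli_real_clusterCapIn_ge_mul_le (Λ : Finset V) (u : V) {N t : ℕ} (ht : 1 ≤ t) :
    (prodBernoulli p).real {ω | (2 * N + 1) * t ≤ clusterCapIn Λ ω u} ≤
      (prodBernoulli p).real {ω | t ≤ clusterCapIn Λ ω u} *
        (prodBernoulli p).real {ω | t ≤ clusterMaxIn Λ ω} ^ N := by
  refine le_trans (measureReal_mono (setOf_clusterCapIn_ge_subset_disjointOccurrenceList Λ u ht)
    (measure_ne_top _ _)) ?_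
  refine le_trans (prodBernoulli_bk_list p _ (fun A hA => ?_) (fun A hA => ?_)) ?_
  · rcases List.mem_cons.1 hA with rfl | hA
    · exact isUpperSet_clusterCapIn_ge Λ u t
    · rw [List.eq_of_mem_replicate hA]; exact isUpperSet_clusterMaxIn_ge Λ t
  · rcases List.mem_cons.1 hA with rfl | hA
    · exact isFinitary_clusterCapIn_ge Λ u t
    · rw [List.eq_of_mem_replicate hA]; exact isFinitary_clusterMaxIn_ge Λ t
  · rw [List.map_cons, List.prod_cons, List.map_replicate, List.prod_replicate]

end Submult

/-! ### The typical value `M(Λ)` -/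

section Typical

variable (μ : Measure (BondConfig V)) (Λ : Finset V)

/-- The defining set of `M(Λ)` is nonempty: `P(|K_max(Λ)| ≥ |Λ| + 1) = 0 ≤ e^{-1}`. [folklore] -/
theorem typicalMax_set_nonempty :
    ({n : ℕ | μ.real {ω | n ≤ clusterMaxIn Λ ω} ≤ Real.exp (-1)}).Nonempty := by
  refine ⟨Λ.card + 1, ?_⟩
  have : {ω : BondConfig V | Λ.card + 1 ≤ clusterMaxIn Λ ω} = ∅ :=
    Set.eq_empty_of_forall_notMem fun ω hω =>
      absurd (le_trans hω (clusterMaxIn_le_card Λ ω)) (by omega)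
  simp only [Set.mem_setOf_eq, this, measureReal_empty]
  exact (Real.exp_pos _).le

/-- **`P(|K_max(Λ)| ≥ M(Λ)) ≤ e^{-1}`.** [cite: Hutchcroft2021, §2.1 (p. 11)] -/
theorem real_typicalMax_le_clusterMaxIn_le :
    μ.real {ω | typicalMax μ Λ ≤ clusterMaxIn Λ ω} ≤ Real.exp (-1) :=
  Nat.sInf_mem (typicalMax_set_nonempty μ Λ)

/-- **`P(|K_max(Λ)| ≥ n) > e^{-1}` for `n < M(Λ)`** (minimality; "the definitions ensure that
`ℙ_β(|K_max(Λ)| ≥ M - 1) ≥ e^{-1}`"). [cite: Hutchcroft2021, proof of Thm. 2.2 (p. 11)] -/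
theorem exp_neg_one_lt_real_of_lt_typicalMax {n : ℕ} (hn : n < typicalMax μ Λ) :
    Real.exp (-1) < μ.real {ω | n ≤ clusterMaxIn Λ ω} := by
  have := Nat.notMem_of_lt_sInf hn
  simpa using this

/-- `M(Λ) ≤ |Λ| + 1`. [folklore] -/
theorem typicalMax_le_card_add_one : typicalMax μ Λ ≤ Λ.card + 1 := by
  refine Nat.sInf_le ?_
  have : {ω : BondConfig V | Λ.card + 1 ≤ clusterMaxIn Λ ω} = ∅ :=
    Set.eq_empty_of_forall_notMem fun ω hω =>
      absurd (le_trans hω (clusterMaxIn_le_card Λ ω)) (by omega)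
  simp only [Set.mem_setOf_eq, this, measureReal_empty]
  exact (Real.exp_pos _).le

variable {Λ}

/-- **`M(Λ) ≥ 2` for nonempty `Λ`** (since `|K_max(Λ)| ≥ 1` surely).
[cite: Hutchcroft2022, §2.2 (p. 7, "we always have M_B ≥ 2")] -/
theorem two_le_typicalMax [IsProbabilityMeasure μ] (hΛ : Λ.Nonempty) : 2 ≤ typicalMax μ Λ := by
  by_contra hlt
  push Not at hlt
  have h := real_typicalMax_le_clusterMaxIn_le μ Λ
  have huniv : {ω : BondConfig V | typicalMax μ Λ ≤ clusterMaxIn Λ ω} = Set.univ :=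
    Set.eq_univ_of_forall fun ω => le_trans (by omega) (one_le_clusterMaxIn hΛ ω)
  rw [huniv, probReal_univ] at h
  have : Real.exp (-1) < 1 := Real.exp_lt_one_iff.2 (by norm_num)
  linarith

end Typical

/-! ### Universal tightness (Hutchcroft 2021, Thm. 2.2) -/

section Tightness

variable [DecidableEq V] [Countable V] (p : Sym2 V → unitInterval) {Λ : Finset V}

/-- **Upper tail of `|K_max(Λ)|` at integer multiples of `M`:**
`P(|K_max(Λ)| ≥ (2N+1) M(Λ)) ≤ e^{-(N+1)}` (nonempty `Λ`). [cite: Hutchcroft2021, Thm. 2.2 (2.3)] -/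
theorem prodBernoulli_real_mul_typicalMax_le_clusterMaxIn_le (hΛ : Λ.Nonempty) (N : ℕ) :
    (prodBernoulli p).real {ω | (2 * N + 1) * typicalMax (prodBernoulli p) Λ ≤ clusterMaxIn Λ ω} ≤
      Real.exp (-(N + 1 : ℝ)) := by
  have hM : 1 ≤ typicalMax (prodBernoulli p) Λ := le_trans (by norm_num) (two_le_typicalMax _ hΛ)
  refine le_trans (prodBernoulli_real_clusterMaxIn_ge_mul_le p Λ hM) ?_
  calc (prodBernoulli p).real {ω | typicalMax (prodBernoulli p) Λ ≤ clusterMaxIn Λ ω} ^ (N + 1)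
      ≤ Real.exp (-1) ^ (N + 1) :=
        pow_le_pow_left₀ measureReal_nonneg (real_typicalMax_le_clusterMaxIn_le _ Λ) _
    _ = Real.exp (-(N + 1 : ℝ)) := by rw [← Real.exp_nat_mul]; congr 1; push_cast; ring

/-- **Universal tightness, upper tail** (Hutchcroft 2021, Thm. 2.2, (2.3): "`ℙ_β(|K_max(Λ)| ≥ α M)
≤ exp(-α/9)`"; here with the constant of the linear witness bound):
`P(|K_max(Λ)| ≥ α M(Λ)) ≤ exp((1-α)/2)` for every real `α ≥ 1` and nonempty `Λ`.
[cite: Hutchcroft2021, Thm. 2.2 (2.3)] -/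
theorem prodBernoulli_real_clusterMaxIn_ge_le_exp (hΛ : Λ.Nonempty) {α : ℝ} (hα : 1 ≤ α) :
    (prodBernoulli p).real {ω | α * typicalMax (prodBernoulli p) Λ ≤ (clusterMaxIn Λ ω : ℝ)} ≤
      Real.exp ((1 - α) / 2) := by
  set M := typicalMax (prodBernoulli p) Λ with hMdef
  set N := ⌊(α - 1) / 2⌋₊ with hN
  have hN1 : (2 * N + 1 : ℝ) ≤ α := by
    have := Nat.floor_le (show 0 ≤ (α - 1) / 2 by linarith)
    rw [← hN] at this; linarith
  have hN2 : (α - 1) / 2 < N + 1 := by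
    have := Nat.lt_floor_add_one ((α - 1) / 2)
    rw [← hN] at this; exact_mod_cast this
  have hsub : {ω : BondConfig V | α * M ≤ (clusterMaxIn Λ ω : ℝ)} ⊆
      {ω | (2 * N + 1) * M ≤ clusterMaxIn Λ ω} := by
    intro ω hω
    simp only [Set.mem_setOf_eq] at hω ⊢
    have hM0 : (0 : ℝ) ≤ M := Nat.cast_nonneg _
    have : ((2 * N + 1) * M : ℕ) ≤ (clusterMaxIn Λ ω : ℝ) := by
      push_cast
      exact le_trans (mul_le_mul_of_nonneg_right hN1 hM0) hω
    exact_mod_cast this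
  refine le_trans (measureReal_mono hsub (measure_ne_top _ _)) ?_
  refine le_trans (prodBernoulli_real_mul_typicalMax_le_clusterMaxIn_le p hΛ N) ?_
  exact Real.exp_le_exp.2 (by linarith)

/-- **Universal tightness, rooted upper tail** (Hutchcroft 2021, Thm. 2.2, (2.5): "`ℙ_β(|K_u ∩ Λ|
≥ α M) ≤ e ℙ_β(|K_u ∩ Λ| ≥ M) exp(-α/9)`"; here with the constant of the linear witness bound):
`P(|K_u ∩ Λ| ≥ α M(Λ)) ≤ exp((3-α)/2) P(|K_u ∩ Λ| ≥ M(Λ))` for real `α ≥ 1`, nonempty `Λ`.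
[cite: Hutchcroft2021, Thm. 2.2 (2.5)] -/
theorem prodBernoulli_real_clusterCapIn_ge_le_exp_mul (hΛ : Λ.Nonempty) (u : V) {α : ℝ}
    (hα : 1 ≤ α) :
    (prodBernoulli p).real {ω | α * typicalMax (prodBernoulli p) Λ ≤ (clusterCapIn Λ ω u : ℝ)} ≤
      Real.exp ((3 - α) / 2) *
        (prodBernoulli p).real {ω | typicalMax (prodBernoulli p) Λ ≤ clusterCapIn Λ ω u} := by
  set M := typicalMax (prodBernoulli p) Λ with hMdef
  have hM : 1 ≤ M := le_trans (by norm_num) (two_le_typicalMax _ hΛ)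
  set N := ⌊(α - 1) / 2⌋₊ with hN
  have hN1 : (2 * N + 1 : ℝ) ≤ α := by
    have := Nat.floor_le (show 0 ≤ (α - 1) / 2 by linarith)
    rw [← hN] at this; linarith
  have hN2 : (α - 1) / 2 < N + 1 := by
    have := Nat.lt_floor_add_one ((α - 1) / 2)
    rw [← hN] at this; exact_mod_cast this
  have hsub : {ω : BondConfig V | α * M ≤ (clusterCapIn Λ ω u : ℝ)} ⊆
      {ω | (2 * N + 1) * M ≤ clusterCapIn Λ ω u} := by
    intro ω hω
    simp only [Set.mem_setOf_eq] at hω ⊢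
    have hM0 : (0 : ℝ) ≤ M := Nat.cast_nonneg _
    have : ((2 * N + 1) * M : ℕ) ≤ (clusterCapIn Λ ω u : ℝ) := by
      push_cast
      exact le_trans (mul_le_mul_of_nonneg_right hN1 hM0) hω
    exact_mod_cast this
  refine le_trans (measureReal_mono hsub (measure_ne_top _ _)) ?_
  refine le_trans (prodBernoulli_real_clusterCapIn_ge_mul_le p Λ u hM) ?_
  rw [mul_comm]
  refine mul_le_mul_of_nonneg_right ?_ measureReal_nonneg
  calc (prodBernoulli p).real {ω | M ≤ clusterMaxIn Λ ω} ^ N ≤ Real.exp (-1) ^ N :=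
        pow_le_pow_left₀ measureReal_nonneg (real_typicalMax_le_clusterMaxIn_le _ Λ) _
    _ = Real.exp (-(N : ℝ)) := by rw [← Real.exp_nat_mul]; congr 1; ring
    _ ≤ Real.exp ((3 - α) / 2) := Real.exp_le_exp.2 (by linarith)

/-- **Universal tightness, lower tail** (Hutchcroft 2021, Thm. 2.2, (2.4): "`ℙ_β(|K_max(Λ)| < ε M)
≤ 27 ε`"; here with the constant of the linear witness bound): `P(|K_max(Λ)| < ε M(Λ)) ≤ 8 ε` for
`ε > 0` and nonempty `Λ`. Proof as printed, with integers: for `ε ≤ 1/8` and `εM ≥ 1` put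
`t = ⌈εM⌉`, `N = ⌊(M-1-t)/(2t)⌋`; then `e^{-1} < P(|K_max| ≥ M-1) ≤ P(|K_max| ≥ (2N+1)t) ≤
P(|K_max| ≥ t)^{N+1}`, so `P(|K_max| < t) ≤ 1 - e^{-1/(N+1)} ≤ 1/(N+1) ≤ 32ε/5`.
[cite: Hutchcroft2021, Thm. 2.2 (2.4) and its proof (p. 11)] -/
theorem prodBernoulli_real_clusterMaxIn_lt_le (hΛ : Λ.Nonempty) {ε : ℝ} (hε : 0 < ε) :
    (prodBernoulli p).real {ω | (clusterMaxIn Λ ω : ℝ) < ε * typicalMax (prodBernoulli p) Λ} ≤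
      8 * ε := by
  set μ := prodBernoulli p with hμ
  set M := typicalMax μ Λ with hMdef
  have hM2 : 2 ≤ M := two_le_typicalMax μ hΛ
  -- trivial unless `ε < 1/8`
  by_cases hε8 : 1 ≤ 8 * ε
  · exact le_trans measureReal_le_one hε8
  push Not at hε8
  -- trivial unless `ε M ≥ 1`
  by_cases hεM : ε * M < 1
  · have : {ω : BondConfig V | (clusterMaxIn Λ ω : ℝ) < ε * M} = ∅ :=
      Set.eq_empty_of_forall_notMem fun ω hω => by
        have h1 : (1 : ℝ) ≤ clusterMaxIn Λ ω := by exact_mod_cast one_le_clusterMaxIn hΛ ω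
        simp only [Set.mem_setOf_eq] at hω
        linarith
    rw [this, measureReal_empty]; linarith
  push Not at hεM
  have hMR : (8 : ℝ) < M := by
    by_contra h; push Not at h
    have : ε * M < 1 := by nlinarith
    linarith
  -- the integers `t` and `N`
  set t := ⌈ε * M⌉₊ with ht
  have ht1 : 1 ≤ t := Nat.one_le_ceil_iff.2 (lt_of_lt_of_le one_pos hεM)
  have htR1 : ε * M ≤ t := Nat.le_ceil _
  have htR2 : (t : ℝ) < ε * M + 1 := Nat.ceil_lt_add_one (by positivity)
  have htM : (t : ℝ) ≤ M / 4 := by nlinarith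
  have htM' : t + 1 ≤ M := by
    have : (t : ℝ) + 1 ≤ M := by nlinarith
    exact_mod_cast this
  set N := (M - 1 - t) / (2 * t) with hN
  have hN1 : (2 * N + 1) * t ≤ M - 1 := by
    have h1 : 2 * t * N ≤ M - 1 - t := Nat.mul_div_le (M - 1 - t) (2 * t)
    have : 2 * N * t + t ≤ M - 1 := by
      have : 2 * t * N = 2 * N * t := by ring
      omega
    linarith [this]
  have hN2 : M - 1 - t < 2 * t * (N + 1) := Nat.lt_mul_div_succ _ (by omega)
  -- the chain of inequalities
  have hchain : Real.exp (-1) < μ.real {ω | t ≤ clusterMaxIn Λ ω} ^ (N + 1) := by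
    calc Real.exp (-1) < μ.real {ω | M - 1 ≤ clusterMaxIn Λ ω} :=
          exp_neg_one_lt_real_of_lt_typicalMax μ Λ (by omega)
      _ ≤ μ.real {ω | (2 * N + 1) * t ≤ clusterMaxIn Λ ω} :=
          measureReal_mono (fun ω hω => le_trans hN1 hω) (measure_ne_top _ _)
      _ ≤ μ.real {ω | t ≤ clusterMaxIn Λ ω} ^ (N + 1) :=
          prodBernoulli_real_clusterMaxIn_ge_mul_le p Λ ht1
  -- the complement bound, then abbreviate `q = P(|K_max| ≥ t)`
  have hcompl : μ.real {ω | (clusterMaxIn Λ ω : ℝ) < ε * M} ≤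
      1 - μ.real {ω | t ≤ clusterMaxIn Λ ω} := by
    have hsub : {ω : BondConfig V | (clusterMaxIn Λ ω : ℝ) < ε * M} ⊆ {ω | t ≤ clusterMaxIn Λ ω}ᶜ := by
      intro ω hω hω'
      simp only [Set.mem_setOf_eq] at hω hω'
      have : (t : ℝ) ≤ clusterMaxIn Λ ω := by exact_mod_cast hω'
      linarith
    refine le_trans (measureReal_mono hsub (measure_ne_top _ _)) (le_of_eq ?_)
    rw [measureReal_compl (measurableSet_clusterMaxIn_ge Λ t), probReal_univ]
  set q := μ.real {ω | t ≤ clusterMaxIn Λ ω} with hq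
  have hq0 : 0 ≤ q := measureReal_nonneg
  -- `q > exp(-1/(N+1))`
  have hNpos : (0 : ℝ) < N + 1 := by positivity
  have hq1 : Real.exp (-1 / (N + 1)) < q := by
    by_contra h
    push Not at h
    have h' : q ^ (N + 1) ≤ Real.exp (-1 / (N + 1)) ^ (N + 1) := pow_le_pow_left₀ hq0 h _
    rw [← Real.exp_nat_mul] at h'
    have : (↑(N + 1) : ℝ) * (-1 / (N + 1)) = -1 := by push_cast; field_simp
    rw [this] at h'
    linarith
  -- hence `P(|K_max| < t) = 1 - q ≤ 1/(N+1)`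
  have hexp : 1 - q ≤ 1 / (N + 1) := by
    have h1 : 1 - Real.exp (-1 / (N + 1)) ≤ 1 / (N + 1) := by
      have := Real.add_one_le_exp (-1 / (N + 1 : ℝ))
      have e : -1 / (N + 1 : ℝ) = -(1 / (N + 1)) := by ring
      linarith
    linarith
  -- and `1/(N+1) ≤ 8 ε`
  have hfinal : 1 / ((N : ℝ) + 1) ≤ 8 * ε := by
    rw [div_le_iff₀ hNpos]
    -- `2t(N+1) > M - 1 - t ≥ 5M/8` and `t ≤ 2 ε M`
    have h1 : ((M - 1 - t : ℕ) : ℝ) < 2 * t * (N + 1) := by exact_mod_cast hN2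
    have h2 : ((M - 1 - t : ℕ) : ℝ) = M - 1 - t := by
      rw [Nat.cast_sub (by omega), Nat.cast_sub (by omega)]; push_cast; ring
    rw [h2] at h1
    have h3 : (t : ℝ) ≤ 2 * (ε * M) := by linarith
    have h4 : 2 * (t : ℝ) * (N + 1) ≤ 4 * ε * (N + 1) * M := by
      have := mul_le_mul_of_nonneg_right h3 (show (0 : ℝ) ≤ 2 * (N + 1) by positivity)
      nlinarith
    have h5 : 5 / 8 * (M : ℝ) ≤ M - 1 - t := by linarith
    have h6 : 5 / 8 * (M : ℝ) < 4 * ε * (N + 1) * M := by linarith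
    have hM0 : (0 : ℝ) ≤ M := by linarith
    have h7 : (5 : ℝ) / 8 < 4 * ε * (N + 1) := lt_of_mul_lt_mul_right h6 hM0
    linarith
  linarith

end Tightness

/-! ### Mean versus typical value (Hutchcroft 2022, (2.7)) -/

section Mean

variable [DecidableEq V] [Countable V]

omit [DecidableEq V] [Countable V] in
/-- Pointwise layer-cake: `|K_max(Λ)| = Σ_{n=1}^{|Λ|} 𝟙[|K_max(Λ)| ≥ n]`. [folklore] -/
theorem clusterMaxIn_eq_sum_indicator (Λ : Finset V) (ω : BondConfig V) :
    (clusterMaxIn Λ ω : ℝ) =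
      ∑ n ∈ Finset.Icc 1 Λ.card,
        ({ω : BondConfig V | n ≤ clusterMaxIn Λ ω}).indicator (fun _ => (1 : ℝ)) ω := by
  have hk := clusterMaxIn_le_card Λ ω
  set k := clusterMaxIn Λ ω with hkdef
  have : ∀ n ∈ Finset.Icc 1 Λ.card, ({ω : BondConfig V | n ≤ clusterMaxIn Λ ω}).indicator
      (fun _ => (1 : ℝ)) ω = if n ≤ k then 1 else 0 := by
    intro n _
    by_cases h : n ≤ k
    · rw [if_pos h, Set.indicator_of_mem (show ω ∈ {ω | n ≤ clusterMaxIn Λ ω} from h)]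
    · rw [if_neg h, Set.indicator_of_notMem (show ω ∉ {ω | n ≤ clusterMaxIn Λ ω} from h)]
  rw [Finset.sum_congr rfl this, Finset.sum_boole]
  have hfilter : (Finset.Icc 1 Λ.card).filter (fun n => n ≤ k) = Finset.Icc 1 k := by
    ext n; simp only [Finset.mem_filter, Finset.mem_Icc]; omega
  rw [hfilter, Nat.card_Icc]
  push_cast [Nat.add_sub_cancel]
  ring

/-- `ω ↦ |K_max(Λ)|(ω)` is integrable (bounded and measurable). [folklore] -/
theorem integrable_clusterMaxIn (μ : Measure (BondConfig V)) [IsProbabilityMeasure μ]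
    (Λ : Finset V) : Integrable (fun ω => (clusterMaxIn Λ ω : ℝ)) μ := by
  have h : (fun ω => (clusterMaxIn Λ ω : ℝ)) = fun ω =>
      ∑ n ∈ Finset.Icc 1 Λ.card,
        ({ω : BondConfig V | n ≤ clusterMaxIn Λ ω}).indicator (fun _ => (1 : ℝ)) ω :=
    funext fun ω => clusterMaxIn_eq_sum_indicator Λ ω
  rw [h]
  exact integrable_finsetSum _ fun n _ =>
    (integrable_const (1 : ℝ)).indicator (measurableSet_clusterMaxIn_ge Λ n)

/-- **Layer-cake formula**: `E|K_max(Λ)| = Σ_{n=1}^{|Λ|} P(|K_max(Λ)| ≥ n)`. [folklore] -/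
theorem integral_clusterMaxIn_eq_sum (μ : Measure (BondConfig V)) [IsProbabilityMeasure μ]
    (Λ : Finset V) :
    ∫ ω, (clusterMaxIn Λ ω : ℝ) ∂μ =
      ∑ n ∈ Finset.Icc 1 Λ.card, μ.real {ω | n ≤ clusterMaxIn Λ ω} := by
  have h : (fun ω => (clusterMaxIn Λ ω : ℝ)) = fun ω =>
      ∑ n ∈ Finset.Icc 1 Λ.card,
        ({ω : BondConfig V | n ≤ clusterMaxIn Λ ω}).indicator (fun _ => (1 : ℝ)) ω :=
    funext fun ω => clusterMaxIn_eq_sum_indicator Λ ω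
  rw [h, integral_finsetSum _ fun n _ =>
    (integrable_const (1 : ℝ)).indicator (measurableSet_clusterMaxIn_ge Λ n)]
  refine Finset.sum_congr rfl fun n _ => ?_
  rw [integral_indicator_const _ (measurableSet_clusterMaxIn_ge Λ n), smul_eq_mul, mul_one]

/-- **Mean versus typical value, lower bound** (Hutchcroft 2022, (2.7): "`(M_B - 1)/e ≤
E|K_B^max|`"): `(M(Λ) - 1) e^{-1} ≤ E|K_max(Λ)|`. [cite: Hutchcroft2022, §2.2 (2.7)] -/
theorem typicalMax_sub_one_mul_exp_le_integral (μ : Measure (BondConfig V)) [IsProbabilityMeasure μ]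
    (Λ : Finset V) :
    ((typicalMax μ Λ : ℝ) - 1) * Real.exp (-1) ≤ ∫ ω, (clusterMaxIn Λ ω : ℝ) ∂μ := by
  set M := typicalMax μ Λ with hM
  rcases Nat.lt_or_ge M 2 with hM2 | hM2
  · -- `M ≤ 1`: the left-hand side is nonpositive
    refine le_trans ?_ (integral_nonneg fun ω => Nat.cast_nonneg _)
    have : (M : ℝ) - 1 ≤ 0 := by
      have : (M : ℝ) ≤ 1 := by exact_mod_cast Nat.le_of_lt_succ hM2
      linarith
    exact mul_nonpos_of_nonpos_of_nonneg this (Real.exp_pos _).le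
  rw [integral_clusterMaxIn_eq_sum]
  have hMcard : M - 1 ≤ Λ.card := by
    have := typicalMax_le_card_add_one μ Λ; omega
  calc ((M : ℝ) - 1) * Real.exp (-1)
      = ∑ n ∈ Finset.Icc 1 (M - 1), Real.exp (-1) := by
        rw [Finset.sum_const, Nat.card_Icc, nsmul_eq_mul]
        congr 1
        rw [show M - 1 + 1 - 1 = M - 1 by omega, Nat.cast_sub (by omega)]
        push_cast; ring
    _ ≤ ∑ n ∈ Finset.Icc 1 (M - 1), μ.real {ω | n ≤ clusterMaxIn Λ ω} :=
        Finset.sum_le_sum fun n hn =>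
          (exp_neg_one_lt_real_of_lt_typicalMax μ Λ (by
            have := (Finset.mem_Icc.1 hn).2; omega)).le
    _ ≤ ∑ n ∈ Finset.Icc 1 Λ.card, μ.real {ω | n ≤ clusterMaxIn Λ ω} :=
        Finset.sum_le_sum_of_subset_of_nonneg
          (Finset.Icc_subset_Icc_right hMcard) fun _ _ _ => measureReal_nonneg

variable (p : Sym2 V → unitInterval)

/-- **Mean versus typical value, upper bound** (Hutchcroft 2022, (2.7): "`E|K_B^max| ≤ 10 M_B`";
here with the constant of the linear witness bound): `E|K_max(Λ)| ≤ 4 M(Λ)` for nonempty `Λ`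
(layer cake, `P(|K_max| ≥ n) ≤ e^{1/2} e^{-n/(2M)}` for `n ≥ M`, and a geometric sum).
[cite: Hutchcroft2022, §2.2 (2.7)] -/
theorem integral_clusterMaxIn_le_four_mul_typicalMax {Λ : Finset V} (hΛ : Λ.Nonempty) :
    ∫ ω, (clusterMaxIn Λ ω : ℝ) ∂(prodBernoulli p) ≤ 4 * typicalMax (prodBernoulli p) Λ := by
  set μ := prodBernoulli p with hμ
  set M := typicalMax μ Λ with hMdef
  have hM2 : 2 ≤ M := two_le_typicalMax μ hΛ
  have hMR : (2 : ℝ) ≤ M := by exact_mod_cast hM2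
  have hM0 : (0 : ℝ) < M := by linarith
  rw [integral_clusterMaxIn_eq_sum]
  -- split the layer-cake sum at `M`
  have hsplit : Finset.Icc 1 Λ.card ⊆ Finset.Icc 1 M ∪ Finset.Ico (M + 1) (Λ.card + 1) := by
    intro n hn
    simp only [Finset.mem_union, Finset.mem_Icc, Finset.mem_Ico] at hn ⊢
    omega
  refine le_trans (Finset.sum_le_sum_of_subset_of_nonneg hsplit fun _ _ _ => measureReal_nonneg) ?_
  have hdisj : Disjoint (Finset.Icc 1 M) (Finset.Ico (M + 1) (Λ.card + 1)) := by
    rw [Finset.disjoint_left]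
    intro n hn hn'
    simp only [Finset.mem_Icc, Finset.mem_Ico] at hn hn'
    omega
  rw [Finset.sum_union hdisj]
  -- the first part has `M` terms `≤ 1`
  have h1 : ∑ n ∈ Finset.Icc 1 M, μ.real {ω | n ≤ clusterMaxIn Λ ω} ≤ M := by
    calc ∑ n ∈ Finset.Icc 1 M, μ.real {ω | n ≤ clusterMaxIn Λ ω}
        ≤ ∑ n ∈ Finset.Icc 1 M, (1 : ℝ) := Finset.sum_le_sum fun n _ => measureReal_le_one
      _ = M := by rw [Finset.sum_const, Nat.card_Icc, nsmul_eq_mul, mul_one]; push_cast; ring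
  -- the second part is dominated by a geometric series with ratio `r = exp(-1/(2M))`
  set r := Real.exp (-1 / (2 * M)) with hr
  have hr0 : 0 ≤ r := (Real.exp_pos _).le
  have hr1 : r < 1 := Real.exp_lt_one_iff.2 (by rw [neg_div]; exact neg_neg_of_pos (by positivity))
  have hterm : ∀ n ∈ Finset.Ico (M + 1) (Λ.card + 1),
      μ.real {ω | n ≤ clusterMaxIn Λ ω} ≤ Real.exp (1 / 2) * r ^ n := by
    intro n hn
    have hnM : M + 1 ≤ n := (Finset.mem_Ico.1 hn).1
    have hα : (1 : ℝ) ≤ n / M := by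
      rw [le_div_iff₀ hM0, one_mul]; exact_mod_cast (by omega : M ≤ n)
    have key := prodBernoulli_real_clusterMaxIn_ge_le_exp p hΛ hα
    have hev : {ω : BondConfig V | n ≤ clusterMaxIn Λ ω} ⊆
        {ω | (n : ℝ) / M * M ≤ (clusterMaxIn Λ ω : ℝ)} := by
      intro ω hω
      simp only [Set.mem_setOf_eq] at hω ⊢
      rw [div_mul_cancel₀ _ hM0.ne']
      exact_mod_cast hω
    refine le_trans (measureReal_mono hev (measure_ne_top _ _)) (le_trans key (le_of_eq ?_))
    rw [hr, ← Real.exp_nat_mul, ← Real.exp_add]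
    congr 1
    field_simp
    ring
  have h2 : ∑ n ∈ Finset.Ico (M + 1) (Λ.card + 1), μ.real {ω | n ≤ clusterMaxIn Λ ω} ≤
      1 + 2 * M := by
    refine le_trans (Finset.sum_le_sum hterm) ?_
    rw [← Finset.mul_sum]
    have hgeom := geom_sum_Ico_le_of_lt_one (m := M + 1) (n := Λ.card + 1) hr0 hr1
    -- `exp(1/2) r^{M+1} / (1-r) ≤ r^M exp(1/2)/(1-r) = 1/(1-r) ≤ 1 + 2M`
    have hrM : r ^ M = Real.exp (-1 / 2) := by
      rw [hr, ← Real.exp_nat_mul]; congr 1; field_simp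
    have h1r : 0 < 1 - r := by linarith
    have hinv : 1 / (1 - r) ≤ 1 + 2 * M := by
      -- `r ≤ 1/(1+x)` with `x = 1/(2M)` since `1 + x ≤ exp x`
      have hx : 0 < 1 / (2 * (M : ℝ)) := by positivity
      have hexp : 1 + 1 / (2 * (M : ℝ)) ≤ Real.exp (1 / (2 * M)) := by
        have := Real.add_one_le_exp (1 / (2 * (M : ℝ))); linarith
      have hr' : r * Real.exp (1 / (2 * M)) = 1 := by
        rw [hr, ← Real.exp_add]; rw [show -1 / (2 * (M : ℝ)) + 1 / (2 * M) = 0 by ring, Real.exp_zero]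
      have hrle : r * (1 + 1 / (2 * M)) ≤ 1 := by
        calc r * (1 + 1 / (2 * M)) ≤ r * Real.exp (1 / (2 * M)) :=
              mul_le_mul_of_nonneg_left hexp hr0
          _ = 1 := hr'
      rw [div_le_iff₀ h1r]
      have : (1 + 2 * (M : ℝ)) * (1 - r) = 1 + 2 * M - 2 * M * (r * (1 + 1 / (2 * M))) := by
        field_simp; ring
      rw [this]
      nlinarith
    calc Real.exp (1 / 2) * ∑ n ∈ Finset.Ico (M + 1) (Λ.card + 1), r ^ n
        ≤ Real.exp (1 / 2) * (r ^ (M + 1) / (1 - r)) :=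
          mul_le_mul_of_nonneg_left hgeom (Real.exp_pos _).le
      _ ≤ Real.exp (1 / 2) * (r ^ M / (1 - r)) := by
          refine mul_le_mul_of_nonneg_left (div_le_div_of_nonneg_right ?_ h1r.le) (Real.exp_pos _).le
          rw [pow_succ]; exact mul_le_of_le_one_right (pow_nonneg hr0 _) hr1.le
      _ = 1 / (1 - r) := by
          rw [hrM, ← mul_div_assoc, ← Real.exp_add]; norm_num
      _ ≤ 1 + 2 * M := hinv
  linarith

end Mean

end Literature.Probability.Percolation

end
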